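import Summits.RiemannHypothesis.RiemannHypothesis.Theorems.EarlyAppointmentsRemainder0XiAbelLowSide

/-!
# ⟨24730⟩ ρ2 v4 — LEAF 1 (`KernelShiftLeaf`), LOWER SIDE of the shift-kernel height sum: Abel/HSW on `[lowStart, x − 67.5]` PROVED

C4 «kernel desk» rh-idea-6 g30, director (CA406)(d).  SUPPORT module for crux r3 `Remainder0Xi` (line rho2_v4), fully proved,
standard axioms; imports = pre-image `…AbelLowSide` (C4 g30, 1bbd9081: `finsum_heightBox_split`, `count_low_le`, and through it
`…HeightSumAbelBound.abel_bound_hsw`, `heightBox`).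
After `…KernelShiftSum.kernelShiftLeaf_of_heightBound` LEAF 1 is the bound `Σᶠ_{far ρ} ord(ρ)·ψ(Re ρ) ≤ cS·log(γ/2π) + ε` for the
REAL kernel `ψ_x(t) = 2/(x − t)²` (`psiDn x t`; increasing on `t < x`).  This file is the LOWER side, the twin of …AbelLowSide with
`φ_dn ↦ ψ`:
★ `lowSide_abel_sq (hx : T_PT − 67.5 ≤ x)`: `|Σᶠ_{14<Re ρ≤x−67.5} ord·ψ(Re ρ) − (∫_{14}^{x−67.5} ψ·log(t/2π))/(2π)| ≤ W_N(x−67.5)·2ψ(x−67.5)`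
   with `2ψ(x − 67.5) = 4/67.5² ≈ 8.78·10⁻⁴` (so this error is `≈ 8.78·10⁻⁴·W_N ≈ 0.0124` absolute at `x ≈ T_PT`);
★ `lowPiece_sq_abs_le`: heights in `(0, 14]` contribute `≤ 21·ψ(14) ≤ 10⁻⁹`;
★ `lowHalf_sq_bound`: the two assembled over `(0, x − 67.5]`;
★ `integral_psiDn_le`: `∫_{14}^{x−67.5} ψ = 2/67.5 − 2/(x − 14) ≤ 2/67.5` and ★ `integral_psiDn_log_le`: the main term
   `(∫_{14}^{x−67.5} ψ·log(t/2π))/(2π) ≤ log((x − 67.5)/2π)·(2/67.5)/(2π)` — i.e. the lower side of LEAF 1 costs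
   `≤ log(x/2π)/(67.5·π) + 8.78·10⁻⁴·W_N(x) + 10⁻⁹` (C3 prices `cS`; the upper side is the BPT-Thm-2 twin of …AbelHighSide).
Nothing here bears on the truth of RH; RH is not proved; 24730 OPEN.
-/

set_option linter.dupNamespace false

namespace Summit.RiemannHypothesis.RiemannHypothesis.Theorems.EarlyAppointmentsRemainder0Xi.KernelLowSide

open Set MeasureTheory intervalIntegral Real
open Literature.NumberTheory.LFunctions
open Summit.RiemannHypothesis.RiemannHypothesis.Cruxes.Remainder0Xi.Rho2V2 (T_PT boxHalfWidth lowStart)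
open Summit.RiemannHypothesis.RiemannHypothesis.Theorems.Splittings.EarlyAppointmentsXiZetaDictionary (xiOrd xiOrd_nonneg)
open Summit.RiemannHypothesis.RiemannHypothesis.Theorems.EarlyAppointmentsRemainder0Xi.HeightSumAbel
  (heightBox heightBox_finite)
open Summit.RiemannHypothesis.RiemannHypothesis.Theorems.EarlyAppointmentsRemainder0Xi.HeightSumAbelBound (abel_bound_hsw)
open Summit.RiemannHypothesis.RiemannHypothesis.Theorems.EarlyAppointmentsRemainder0Xi.AbelLowSide
  (finsum_heightBox_split count_low_le)

/-- the shift kernel `ψ_x(t) = 2/(x − t)²` … -/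
noncomputable def psiDn (x t : ℝ) : ℝ := 2 / (x - t) ^ 2

/-- … and its derivative `4/(x − t)³` (nonnegative for `t < x`). -/
noncomputable def psiDn' (x t : ℝ) : ℝ := 4 / (x - t) ^ 3

/-- The low-side shift kernel `psiDn x` has derivative `psiDn' x t` at every `t ≠ x`. -/
theorem hasDerivAt_psiDn {x t : ℝ} (ht : t ≠ x) : HasDerivAt (psiDn x) (psiDn' x t) t := by
  have hxt : x - t ≠ 0 := sub_ne_zero.2 (Ne.symm ht)
  have h1 : HasDerivAt (fun s : ℝ ↦ (x - s) ^ 2) (-(2 * (x - t))) t := by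
    have h := ((hasDerivAt_id t).const_sub x).mul ((hasDerivAt_id t).const_sub x)
    have e1 : (fun s : ℝ ↦ (x - s) ^ 2) = fun s ↦ (x - id s) * (x - id s) := by
      funext s; simp only [id, sq]
    have e2 : -(2 * (x - t)) = -1 * (x - id t) + (x - id t) * -1 := by simp only [id]; ring
    rw [e1, e2]
    exact h
  have hne : (x - t) ^ 2 ≠ 0 := pow_ne_zero 2 hxt
  have h := (hasDerivAt_const t (2 : ℝ)).div h1 hne
  have e : (0 * (x - t) ^ 2 - 2 * -(2 * (x - t))) / ((x - t) ^ 2) ^ 2 = 4 / (x - t) ^ 3 := by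
    rw [div_eq_div_iff (pow_ne_zero 2 hne) (pow_ne_zero 3 hxt)]
    ring
  rw [e] at h
  exact h

/-- an antiderivative of `ψ`: `d/dt (2/(x − t)) = 2/(x − t)²`. -/
theorem hasDerivAt_two_div {x t : ℝ} (ht : t ≠ x) : HasDerivAt (fun s : ℝ ↦ 2 / (x - s)) (psiDn x t) t := by
  have hxt : x - t ≠ 0 := sub_ne_zero.2 (Ne.symm ht)
  have h1 : HasDerivAt (fun s : ℝ ↦ x - s) (-1) t := (hasDerivAt_id t).const_sub x
  have h := (hasDerivAt_const t (2 : ℝ)).div h1 hxt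
  have e : (0 * (x - t) - 2 * -1) / (x - t) ^ 2 = psiDn x t := by
    unfold psiDn
    ring
  rw [e] at h
  exact h

/-- ★ (K) **LOWER SIDE of LEAF 1's height sum**: for `x ≥ T_PT − 67.5`,
`|Σᶠ_{14<Re ρ≤x−67.5} ord·ψ(Re ρ) − (∫_{14}^{x−67.5} ψ·log(t/2π))/(2π)| ≤ W_N(x−67.5)·(2·ψ(x−67.5))`. -/
theorem lowSide_abel_sq {x : ℝ} (hx : T_PT - boxHalfWidth ≤ x) :
    |∑ᶠ ρ ∈ heightBox lowStart (x - boxHalfWidth), ((analyticOrderAt riemannXiUpper ρ).toNat : ℝ) * psiDn x ρ.re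
        - (∫ t in lowStart..(x - boxHalfWidth), psiDn x t * Real.log (t / (2 * π))) / (2 * π)|
      ≤ (0.1038 * Real.log (x - boxHalfWidth) + 0.2573 * Real.log (Real.log (x - boxHalfWidth)) + 10.2425)
          * (2 * psiDn x (x - boxHalfWidth)) := by
  have hT : T_PT = 3000175332800 := rfl
  have hB : boxHalfWidth = 135 / 2 := rfl
  have hL : lowStart = 14 := rfl
  rw [hT, hB] at hx
  rw [hL, hB]
  have hb14 : (14 : ℝ) ≤ x - 135 / 2 := by linarith
  have hlt : ∀ t ∈ Icc (14 : ℝ) (x - 135 / 2), t < x := fun t ht ↦ by linarith [ht.2]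
  have hφ : ∀ t ∈ Icc (14 : ℝ) (x - 135 / 2), HasDerivAt (psiDn x) (psiDn' x t) t :=
    fun t ht ↦ hasDerivAt_psiDn (hlt t ht).ne
  have hφ' : ContinuousOn (psiDn' x) (Icc 14 (x - 135 / 2)) := by
    unfold psiDn'
    refine ContinuousOn.div (by fun_prop) (by fun_prop) fun t ht ↦ ?_
    exact pow_ne_zero 3 (sub_ne_zero.2 (hlt t ht).ne')
  have hsign : (∀ t ∈ Icc (14 : ℝ) (x - 135 / 2), 0 ≤ psiDn' x t) ∨
      (∀ t ∈ Icc (14 : ℝ) (x - 135 / 2), psiDn' x t ≤ 0) := Or.inl fun t ht ↦ by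
    unfold psiDn'
    have h0 : 0 < x - t := by linarith [hlt t ht]
    positivity
  have he : Real.exp 1 ≤ 14 := by linarith [Real.exp_one_lt_d9]
  have h := abel_bound_hsw (a := 14) (b := x - 135 / 2) he hb14 hφ hφ' hsign
  have hpos14 : 0 < psiDn x 14 := by
    unfold psiDn
    exact div_pos two_pos (pow_pos (by linarith) 2)
  have hmono : psiDn x 14 ≤ psiDn x (x - 135 / 2) := by
    unfold psiDn
    exact div_le_div_of_nonneg_left (by norm_num) (pow_pos (by norm_num) 2) (by nlinarith)
  have hposb : 0 < psiDn x (x - 135 / 2) := lt_of_lt_of_le hpos14 hmono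
  have e3 : |psiDn x 14| + |psiDn x (x - 135 / 2)| + |psiDn x (x - 135 / 2) - psiDn x 14| =
      2 * psiDn x (x - 135 / 2) := by
    rw [abs_of_pos hpos14, abs_of_pos hposb, abs_of_nonneg (by linarith)]
    ring
  rw [e3] at h
  exact h

/-- (K) the value at the edge: `2·ψ(x − 67.5) = 4/67.5²`. -/
theorem two_psiDn_edge (x : ℝ) : 2 * psiDn x (x - boxHalfWidth) = 4 / boxHalfWidth ^ 2 := by
  unfold psiDn
  have hB : boxHalfWidth = 135 / 2 := rfl
  rw [hB]
  ring

/-- ★ (K) the `(0, 14]` piece is negligible: `|Σᶠ_{0<Re ρ≤14} ord·ψ(Re ρ)| ≤ 10⁻⁹` for `x ≥ T_PT − 67.5`. -/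
theorem lowPiece_sq_abs_le {x : ℝ} (hx : T_PT - boxHalfWidth ≤ x) :
    |∑ᶠ ρ ∈ heightBox 0 lowStart, ((analyticOrderAt riemannXiUpper ρ).toNat : ℝ) * psiDn x ρ.re| ≤ 1 / 10 ^ 9 := by
  have hT : T_PT = 3000175332800 := rfl
  have hB : boxHalfWidth = 135 / 2 := rfl
  have hL : lowStart = 14 := rfl
  rw [hT, hB] at hx
  have hfin := heightBox_finite 0 lowStart
  have hsup : ∀ ρ ∈ heightBox 0 lowStart, |((analyticOrderAt riemannXiUpper ρ).toNat : ℝ) * psiDn x ρ.re| ≤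
      xiOrd ρ * (2 / (x - 14) ^ 2) := by
    rintro ρ ⟨-, h1, h2⟩
    rw [hL] at h2
    have hφ0 : 0 ≤ psiDn x ρ.re := by unfold psiDn; positivity
    have hφle : psiDn x ρ.re ≤ 2 / (x - 14) ^ 2 := by
      unfold psiDn
      exact div_le_div_of_nonneg_left (by norm_num) (pow_pos (by linarith) 2) (by nlinarith)
    rw [abs_of_nonneg (mul_nonneg (Nat.cast_nonneg _) hφ0)]
    exact mul_le_mul_of_nonneg_left hφle (Nat.cast_nonneg _)
  have hsum : |∑ᶠ ρ ∈ heightBox 0 lowStart, ((analyticOrderAt riemannXiUpper ρ).toNat : ℝ) * psiDn x ρ.re| ≤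
      (∑ᶠ ρ ∈ heightBox 0 lowStart, xiOrd ρ) * (2 / (x - 14) ^ 2) := by
    rw [finsum_mem_eq_finite_toFinset_sum _ hfin, finsum_mem_eq_finite_toFinset_sum _ hfin, Finset.sum_mul]
    refine (Finset.abs_sum_le_sum_abs _ _).trans (Finset.sum_le_sum fun ρ hρ ↦ ?_)
    exact hsup ρ (hfin.mem_toFinset.1 hρ)
  have hcount : ∑ᶠ ρ ∈ heightBox 0 lowStart, xiOrd ρ ≤ 21 := count_low_le
  have hφ14 : 0 ≤ 2 / (x - 14) ^ 2 := by positivity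
  have hnum : 21 * (2 / (x - 14) ^ 2) ≤ 1 / 10 ^ 9 := by
    rw [← mul_div_assoc, div_le_div_iff₀ (pow_pos (by linarith) 2) (by norm_num)]
    nlinarith
  calc _ ≤ (∑ᶠ ρ ∈ heightBox 0 lowStart, xiOrd ρ) * (2 / (x - 14) ^ 2) := hsum
    _ ≤ 21 * (2 / (x - 14) ^ 2) := mul_le_mul_of_nonneg_right hcount hφ14
    _ ≤ 1 / 10 ^ 9 := hnum

/-- ★ (K) **LOWER HALF of LEAF 1's height sum, assembled** over heights `(0, x − 67.5]`:
`|Σᶠ_{0<Re ρ≤x−67.5} ord·ψ − (∫_{14}^{x−67.5} ψ·log(t/2π))/(2π)| ≤ W_N(x−67.5)·2ψ(x−67.5) + 10⁻⁹`. -/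
theorem lowHalf_sq_bound {x : ℝ} (hx : T_PT - boxHalfWidth ≤ x) :
    |∑ᶠ ρ ∈ heightBox 0 (x - boxHalfWidth), ((analyticOrderAt riemannXiUpper ρ).toNat : ℝ) * psiDn x ρ.re
        - (∫ t in lowStart..(x - boxHalfWidth), psiDn x t * Real.log (t / (2 * π))) / (2 * π)|
      ≤ (0.1038 * Real.log (x - boxHalfWidth) + 0.2573 * Real.log (Real.log (x - boxHalfWidth)) + 10.2425)
          * (2 * psiDn x (x - boxHalfWidth)) + 1 / 10 ^ 9 := by
  have hT : T_PT = 3000175332800 := rfl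
  have hB : boxHalfWidth = 135 / 2 := rfl
  have hL : lowStart = 14 := rfl
  have h1 := lowSide_abel_sq hx
  have h2 := lowPiece_sq_abs_le hx
  have hsplit := finsum_heightBox_split (a := 0) (b := lowStart) (c := x - boxHalfWidth) (by rw [hL]; norm_num)
    (by rw [hL, hB]; rw [hT, hB] at hx; linarith)
    (fun ρ ↦ ((analyticOrderAt riemannXiUpper ρ).toNat : ℝ) * psiDn x ρ.re)
  rw [hsplit]
  have key := abs_add_le (∑ᶠ ρ ∈ heightBox 0 lowStart, ((analyticOrderAt riemannXiUpper ρ).toNat : ℝ) * psiDn x ρ.re)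
    (∑ᶠ ρ ∈ heightBox lowStart (x - boxHalfWidth), ((analyticOrderAt riemannXiUpper ρ).toNat : ℝ) * psiDn x ρ.re
      - (∫ t in lowStart..(x - boxHalfWidth), psiDn x t * Real.log (t / (2 * π))) / (2 * π))
  rw [← add_sub_assoc] at key
  linarith

/-- ★ (K) the kernel integral: `∫_{14}^{x−67.5} ψ = 2/67.5 − 2/(x − 14) ≤ 2/67.5`. -/
theorem integral_psiDn_eq {x : ℝ} (hx : T_PT - boxHalfWidth ≤ x) :
    ∫ t in lowStart..(x - boxHalfWidth), psiDn x t = 2 / boxHalfWidth - 2 / (x - lowStart) := by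
  have hT : T_PT = 3000175332800 := rfl
  have hB : boxHalfWidth = 135 / 2 := rfl
  have hL : lowStart = 14 := rfl
  rw [hT, hB] at hx
  rw [hL, hB]
  have hb14 : (14 : ℝ) ≤ x - 135 / 2 := by linarith
  have hlt : ∀ t ∈ uIcc (14 : ℝ) (x - 135 / 2), t < x := by
    intro t ht
    rw [uIcc_of_le hb14] at ht
    linarith [ht.2]
  have hderiv : ∀ t ∈ uIcc (14 : ℝ) (x - 135 / 2), HasDerivAt (fun s : ℝ ↦ 2 / (x - s)) (psiDn x t) t :=
    fun t ht ↦ hasDerivAt_two_div (hlt t ht).ne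
  have hcont : ContinuousOn (psiDn x) (uIcc 14 (x - 135 / 2)) := by
    unfold psiDn
    refine ContinuousOn.div (by fun_prop) (by fun_prop) fun t ht ↦ ?_
    exact pow_ne_zero 2 (sub_ne_zero.2 (hlt t ht).ne')
  have hint : IntervalIntegrable (psiDn x) volume 14 (x - 135 / 2) := hcont.intervalIntegrable
  rw [integral_eq_sub_of_hasDerivAt hderiv hint]
  have h1 : x - (x - 135 / 2) = 135 / 2 := by ring
  rw [h1]

/-- The low-side integral of `psiDn x` over `[lowStart, x − boxHalfWidth]` is at most `2/boxHalfWidth`. -/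
theorem integral_psiDn_le {x : ℝ} (hx : T_PT - boxHalfWidth ≤ x) :
    ∫ t in lowStart..(x - boxHalfWidth), psiDn x t ≤ 2 / boxHalfWidth := by
  rw [integral_psiDn_eq hx]
  have hT : T_PT = 3000175332800 := rfl
  have hB : boxHalfWidth = 135 / 2 := rfl
  have hL : lowStart = 14 := rfl
  rw [hT, hB] at hx
  rw [hL]
  have h : 0 ≤ 2 / (x - 14) := by
    apply div_nonneg (by norm_num)
    linarith
  linarith

/-- ★ (K) **THE MAIN TERM of LEAF 1's lower side**: `(∫_{14}^{x−67.5} ψ·log(t/2π))/(2π) ≤ log((x − 67.5)/2π)·(2/67.5)/(2π)`. -/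
theorem integral_psiDn_log_le {x : ℝ} (hx : T_PT - boxHalfWidth ≤ x) :
    (∫ t in lowStart..(x - boxHalfWidth), psiDn x t * Real.log (t / (2 * π))) / (2 * π)
      ≤ Real.log ((x - boxHalfWidth) / (2 * π)) * (2 / boxHalfWidth) / (2 * π) := by
  have hT : T_PT = 3000175332800 := rfl
  have hB : boxHalfWidth = 135 / 2 := rfl
  have hL : lowStart = 14 := rfl
  have hx' := hx
  rw [hT, hB] at hx'
  have hb14 : lowStart ≤ x - boxHalfWidth := by rw [hL, hB]; linarith
  have h2pi : 0 < 2 * π := by positivity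
  have hlt : ∀ t ∈ Icc lowStart (x - boxHalfWidth), t < x := by
    intro t ht; have := ht.2; rw [hB] at this; linarith
  have hcont : ContinuousOn (psiDn x) (Icc lowStart (x - boxHalfWidth)) := by
    unfold psiDn
    refine ContinuousOn.div (by fun_prop) (by fun_prop) fun t ht ↦ ?_
    exact pow_ne_zero 2 (sub_ne_zero.2 (hlt t ht).ne')
  have hlogc : ContinuousOn (fun t : ℝ ↦ Real.log (t / (2 * π))) (Icc lowStart (x - boxHalfWidth)) := by
    refine ContinuousOn.log (by fun_prop) fun t ht ↦ ?_
    have : 0 < t := by have := ht.1; rw [hL] at this; linarith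
    positivity
  have hmono : ∀ t ∈ Icc lowStart (x - boxHalfWidth),
      psiDn x t * Real.log (t / (2 * π)) ≤ psiDn x t * Real.log ((x - boxHalfWidth) / (2 * π)) := by
    intro t ht
    have ht0 : 0 < t := by have := ht.1; rw [hL] at this; linarith
    have hψ : 0 ≤ psiDn x t := by unfold psiDn; positivity
    refine mul_le_mul_of_nonneg_left (Real.log_le_log (by positivity) ?_) hψ
    exact div_le_div_of_nonneg_right ht.2 h2pi.le
  have hI : ∫ t in lowStart..(x - boxHalfWidth), psiDn x t * Real.log (t / (2 * π))
      ≤ ∫ t in lowStart..(x - boxHalfWidth), psiDn x t * Real.log ((x - boxHalfWidth) / (2 * π)) := by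
    refine intervalIntegral.integral_mono_on hb14 ?_ ?_ hmono
    · exact (hcont.mul hlogc).intervalIntegrable_of_Icc hb14
    · exact (hcont.mul continuousOn_const).intervalIntegrable_of_Icc hb14
  rw [intervalIntegral.integral_mul_const] at hI
  have hlog0 : 0 ≤ Real.log ((x - boxHalfWidth) / (2 * π)) := by
    apply Real.log_nonneg
    rw [le_div_iff₀ h2pi, hB]
    nlinarith [Real.pi_lt_four]
  have hJ := mul_le_mul_of_nonneg_right (integral_psiDn_le hx) hlog0
  have hK : ∫ t in lowStart..(x - boxHalfWidth), psiDn x t * Real.log (t / (2 * π))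
      ≤ Real.log ((x - boxHalfWidth) / (2 * π)) * (2 / boxHalfWidth) :=
    hI.trans (hJ.trans_eq (by ring))
  exact div_le_div_of_nonneg_right hK h2pi.le

end Summit.RiemannHypothesis.RiemannHypothesis.Theorems.EarlyAppointmentsRemainder0Xi.KernelLowSide
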